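import Mathlib.Analysis.PSeries
import Mathlib.Analysis.Calculus.BumpFunction.FiniteDimension
import Mathlib.MeasureTheory.Integral.IntervalIntegral.Basic
import Mathlib.Algebra.Order.Floor.Ring
import HarnessLib

/-!
# Pair counts of finite point configurations: binning, tails, smooth box approximants (proved)

Trunk T-ANT (`Literature/NumberTheory/LFunctions`). Proofs only: no definitions, no named facts,
nothing about `ζ`. Generic tools for the equivalence between Montgomery's pair correlation
conjecture (box statistics of differences of zeta ordinates) and the `2`-level GUE hypothesis
(Schwartz test functions), `ZeroStatistics.lean`:

* `PairCount.card_filter_floor_sub_floor_eq_le`: for a finite configuration `p : κ → ℝ` on `s` and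
  every integer `t`, the number of ordered pairs whose unit bins differ by `t`,
  `#{(a, c) : ⌊p a⌋ − ⌊p c⌋ = t}`, is at most `P₁ = #{(a, c) : |p a − p c| ≤ 1}` (Cauchy–Schwarz over
  the bins: `∑_k n_k n_{k+t} ≤ ∑_k n_k²`, and same-bin pairs are `1`-close).
* `PairCount.sum_inv_sq_filter_lt_le`: the tail bound
  `∑_{(a,c) : |p a − p c| > K} (1 + |p a − p c|)^{-2} ≤ (4/K) P₁` (`K ≥ 1`), uniformly in the
  configuration — the input that lets box statistics control Schwartz statistics.
* `PairCount.exists_smooth_ge_indicator_Icc`, `PairCount.exists_smooth_le_indicator_Icc`: smooth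
  compactly supported `0 ≤ h ≤ 1` squeezing the indicator of `[α, β]` from above / below
  (Mathlib's `ContDiffBump`), and `PairCount.integral_mul_le_of_indicator_squeeze`: the
  corresponding squeeze `∫_a^b w ≤ ∫ h w ≤ ∫_{a'}^{b'} w` for a weight `0 ≤ w ≤ 1`.

## References

* H. L. Montgomery, *The pair correlation of zeros of the zeta function*, Proc. Sympos. Pure Math.
  24 (1973), 181–193.
* Z. Rudnick, P. Sarnak, *Zeros of principal `L`-functions and random matrix theory*, Duke Math.
  J. 81 (1996), 269–322, §1 Remark 1.
-/

noncomputable section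

open Finset MeasureTheory
open scoped ContDiff

namespace Literature.NumberTheory.LFunctions

namespace PairCount

variable {κ : Type*}

/-! ## Unit bins -/

/-- The bin difference is within `1` of the difference: `|(x − y) − (⌊x⌋ − ⌊y⌋)| < 1`. [folklore] -/
theorem abs_sub_sub_floor_sub_floor_lt (x y : ℝ) : |(x - y) - ((⌊x⌋ - ⌊y⌋ : ℤ) : ℝ)| < 1 := by
  have h1 := Int.floor_le x
  have h2 := Int.lt_floor_add_one x
  have h3 := Int.floor_le y
  have h4 := Int.lt_floor_add_one y
  push_cast
  rw [abs_lt]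
  constructor <;> linarith

/-- `|⌊x⌋ − ⌊y⌋| < |x − y| + 1`. [folklore] -/
theorem abs_floor_sub_floor_lt (x y : ℝ) : |((⌊x⌋ - ⌊y⌋ : ℤ) : ℝ)| < |x - y| + 1 := by
  have h := abs_sub_sub_floor_sub_floor_lt x y
  have h' := abs_sub_abs_le_abs_sub (((⌊x⌋ - ⌊y⌋ : ℤ) : ℝ)) (x - y)
  rw [abs_sub_comm] at h
  linarith

/-- `|x − y| < |⌊x⌋ − ⌊y⌋| + 1`. [folklore] -/
theorem abs_sub_lt_abs_floor_sub_floor (x y : ℝ) : |x - y| < |((⌊x⌋ - ⌊y⌋ : ℤ) : ℝ)| + 1 := by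
  have h := abs_sub_sub_floor_sub_floor_lt x y
  have h' := abs_sub_abs_le_abs_sub (x - y) (((⌊x⌋ - ⌊y⌋ : ℤ) : ℝ))
  linarith

/-- Points in the same unit bin are `1`-close: `⌊x⌋ = ⌊y⌋ → |x − y| ≤ 1`. [folklore] -/
theorem abs_sub_le_one_of_floor_eq {x y : ℝ} (h : ⌊x⌋ = ⌊y⌋) : |x - y| ≤ 1 := by
  have := abs_floor_sub_floor_lt x y
  rw [h, sub_self, Int.cast_zero, abs_zero] at this
  have h1 := Int.floor_le x
  have h2 := Int.lt_floor_add_one x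
  have h3 := Int.floor_le y
  have h4 := Int.lt_floor_add_one y
  rw [h] at h1 h2
  rw [abs_le]
  constructor <;> linarith

/-- The pairs with prescribed bins `(k + t, k)` form a product of two fibres. [folklore] -/
theorem filter_floor_eq_prod (s : Finset κ) (p : κ → ℝ) (k t : ℤ) :
    ((s ×ˢ s).filter fun q : κ × κ ↦ ⌊p q.2⌋ = k ∧ ⌊p q.1⌋ = k + t) =
      (s.filter fun c ↦ ⌊p c⌋ = k + t) ×ˢ (s.filter fun c ↦ ⌊p c⌋ = k) := by
  ext q
  simp only [mem_filter, mem_product]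
  tauto

/-- Fibrewise count: `#{(a, c) ∈ s² : ⌊p a⌋ − ⌊p c⌋ = t} = ∑_k n_{k+t} n_k`, the sum over the bins
`k` of the points of `s`, `n_k = #{c ∈ s : ⌊p c⌋ = k}`. [folklore] -/
theorem card_filter_floor_sub_floor_eq (s : Finset κ) (p : κ → ℝ) (t : ℤ) :
    ((s ×ˢ s).filter fun q : κ × κ ↦ ⌊p q.1⌋ - ⌊p q.2⌋ = t).card =
      ∑ k ∈ s.image fun c ↦ ⌊p c⌋,
        (s.filter fun c ↦ ⌊p c⌋ = k + t).card * (s.filter fun c ↦ ⌊p c⌋ = k).card := by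
  classical
  rw [card_eq_sum_card_fiberwise (f := fun q : κ × κ ↦ ⌊p q.2⌋) (t := s.image fun c ↦ ⌊p c⌋)]
  · refine sum_congr rfl fun k _ ↦ ?_
    rw [← card_product, ← filter_floor_eq_prod, filter_filter]
    congr 1
    ext q
    simp only [mem_filter, mem_product, and_congr_right_iff]
    intro _
    constructor
    · rintro ⟨h1, h2⟩
      exact ⟨h2, by omega⟩
    · rintro ⟨h1, h2⟩
      exact ⟨by omega, h1⟩
  · intro q hq
    simp only [coe_filter, Set.mem_setOf_eq, mem_product] at hq
    exact mem_image_of_mem _ hq.1.2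

/-- `∑_k n_{k+t}² ≤ ∑_k n_k²` (sum over the bins of `s`; reindex `k ↦ k + t`, the fibres over
non-bins being empty). [folklore] -/
theorem sum_card_filter_floor_add_sq_le (s : Finset κ) (p : κ → ℝ) (t : ℤ) :
    ∑ k ∈ s.image (fun c ↦ ⌊p c⌋), ((s.filter fun c ↦ ⌊p c⌋ = k + t).card : ℝ) ^ 2 ≤
      ∑ k ∈ s.image (fun c ↦ ⌊p c⌋), ((s.filter fun c ↦ ⌊p c⌋ = k).card : ℝ) ^ 2 := by
  classical
  set B := s.image fun c ↦ ⌊p c⌋ with hB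
  set n : ℤ → ℝ := fun k ↦ ((s.filter fun c ↦ ⌊p c⌋ = k).card : ℝ) with hn
  have hzero : ∀ k, k ∉ B → n k = 0 := by
    intro k hk
    simp only [hn, Nat.cast_eq_zero, card_eq_zero, filter_eq_empty_iff]
    intro c hc hck
    exact hk (hck ▸ mem_image_of_mem _ hc)
  have h1 : ∑ k ∈ B, n (k + t) ^ 2 = ∑ k' ∈ B.image (· + t), n k' ^ 2 :=
    (sum_image (s := B) (g := (· + t)) (f := fun k' ↦ n k' ^ 2)
      fun a _ b _ hab ↦ by simpa using hab).symm
  have h2 : ∑ k' ∈ B.image (· + t), n k' ^ 2 ≤ ∑ k' ∈ B.image (· + t) ∪ B, n k' ^ 2 :=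
    sum_le_sum_of_subset_of_nonneg subset_union_left fun k _ _ ↦ by positivity
  have h3 : ∑ k' ∈ B.image (· + t) ∪ B, n k' ^ 2 = ∑ k' ∈ B, n k' ^ 2 := by
    symm
    refine sum_subset subset_union_right fun k hk hkB ↦ ?_
    rw [hzero k hkB]
    ring
  change ∑ k ∈ B, n (k + t) ^ 2 ≤ ∑ k ∈ B, n k ^ 2
  rw [h1]
  exact h2.trans h3.le

/-- Same-bin pairs are `1`-close: `∑_k n_k² ≤ P₁ = #{(a, c) ∈ s² : |p a − p c| ≤ 1}`. [folklore] -/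
theorem sum_card_filter_floor_sq_le (s : Finset κ) (p : κ → ℝ) :
    ∑ k ∈ s.image (fun c ↦ ⌊p c⌋), ((s.filter fun c ↦ ⌊p c⌋ = k).card : ℝ) ^ 2 ≤
      ((s ×ˢ s).filter fun q : κ × κ ↦ |p q.1 - p q.2| ≤ 1).card := by
  classical
  have h0 := card_filter_floor_sub_floor_eq s p 0
  simp only [add_zero] at h0
  have h1 : ∑ k ∈ s.image (fun c ↦ ⌊p c⌋), ((s.filter fun c ↦ ⌊p c⌋ = k).card : ℝ) ^ 2 =
      (((s ×ˢ s).filter fun q : κ × κ ↦ ⌊p q.1⌋ - ⌊p q.2⌋ = 0).card : ℝ) := by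
    rw [h0]
    push_cast
    refine sum_congr rfl fun k _ ↦ ?_
    ring
  rw [h1]
  exact_mod_cast card_le_card fun q hq ↦ by
    simp only [mem_filter] at hq ⊢
    exact ⟨hq.1, abs_sub_le_one_of_floor_eq (by omega)⟩

/-- **Shifted-bin pairs.** For every integer `t`,
`#{(a, c) ∈ s² : ⌊p a⌋ − ⌊p c⌋ = t} ≤ P₁ = #{(a, c) ∈ s² : |p a − p c| ≤ 1}`: the left side is
`∑_k n_{k+t} n_k ≤ (∑_k n_{k+t}² + ∑_k n_k²)/2 ≤ ∑_k n_k² ≤ P₁`. [folklore] -/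
theorem card_filter_floor_sub_floor_eq_le (s : Finset κ) (p : κ → ℝ) (t : ℤ) :
    (((s ×ˢ s).filter fun q : κ × κ ↦ ⌊p q.1⌋ - ⌊p q.2⌋ = t).card : ℝ) ≤
      ((s ×ˢ s).filter fun q : κ × κ ↦ |p q.1 - p q.2| ≤ 1).card := by
  classical
  set B := s.image fun c ↦ ⌊p c⌋ with hB
  set n : ℤ → ℝ := fun k ↦ ((s.filter fun c ↦ ⌊p c⌋ = k).card : ℝ) with hn
  have hcount : (((s ×ˢ s).filter fun q : κ × κ ↦ ⌊p q.1⌋ - ⌊p q.2⌋ = t).card : ℝ) =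
      ∑ k ∈ B, n (k + t) * n k := by
    rw [card_filter_floor_sub_floor_eq]
    push_cast
    rfl
  have hY := sum_card_filter_floor_add_sq_le s p t
  have hX := sum_card_filter_floor_sq_le s p
  have hamgm : ∑ k ∈ B, n (k + t) * n k ≤ (∑ k ∈ B, n (k + t) ^ 2 + ∑ k ∈ B, n k ^ 2) / 2 := by
    rw [le_div_iff₀ (by norm_num : (0 : ℝ) < 2), ← sum_add_distrib, sum_mul]
    refine sum_le_sum fun k _ ↦ ?_
    nlinarith [sq_nonneg (n (k + t) - n k)]
  rw [hcount]
  change ∑ k ∈ B, n (k + t) ^ 2 ≤ ∑ k ∈ B, n k ^ 2 at hY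
  change ∑ k ∈ B, n k ^ 2 ≤ _ at hX
  linarith

/-! ## The tail bound -/

/-- **Tail bound.** For a finite configuration `p` on `s` and `K ≥ 1`:
`∑_{(a,c) ∈ s², |p a − p c| > K} (1 + |p a − p c|)^{-2} ≤ (4/K) · #{(a, c) ∈ s² : |p a − p c| ≤ 1}`.
Group the pairs by `t = ⌊p a⌋ − ⌊p c⌋`: then `|t| ≥ K`, the summand is `≤ t^{-2}`, each group has
at most `P₁` members (`card_filter_floor_sub_floor_eq_le`), and `∑_{|t| ≥ K} t^{-2} ≤ 4/K`. [folklore] -/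
theorem sum_inv_sq_filter_lt_le (s : Finset κ) (p : κ → ℝ) {K : ℕ} (hK : 1 ≤ K) :
    ∑ q ∈ (s ×ˢ s).filter (fun q : κ × κ ↦ (K : ℝ) < |p q.1 - p q.2|),
        ((1 + |p q.1 - p q.2|) ^ 2)⁻¹ ≤
      (4 : ℝ) / K * (((s ×ˢ s).filter fun q : κ × κ ↦ |p q.1 - p q.2| ≤ 1).card : ℝ) := by
  classical
  set P : ℝ := (((s ×ˢ s).filter fun q : κ × κ ↦ |p q.1 - p q.2| ≤ 1).card : ℝ) with hP
  set T := (s ×ˢ s).filter (fun q : κ × κ ↦ (K : ℝ) < |p q.1 - p q.2|) with hT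
  set τ : κ × κ → ℤ := fun q ↦ ⌊p q.1⌋ - ⌊p q.2⌋ with hτ
  have hP0 : 0 ≤ P := Nat.cast_nonneg _
  have hK0 : (0 : ℝ) < K := by exact_mod_cast hK
  -- in the tail, `|t| ≥ K` and the summand is at most `t⁻²`
  have hτK : ∀ q ∈ T, (K : ℝ) ≤ |(τ q : ℝ)| := by
    intro q hq
    rw [hT, mem_filter] at hq
    have h1 := abs_sub_lt_abs_floor_sub_floor (p q.1) (p q.2)
    have h2 : ((K : ℤ) : ℝ) - 1 < |((τ q : ℤ) : ℝ)| := by push_cast; linarith [hq.2]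
    have h3 : (K : ℤ) - 1 < |τ q| := by
      have : (((K : ℤ) - 1 : ℤ) : ℝ) < ((|τ q| : ℤ) : ℝ) := by push_cast; exact_mod_cast h2
      exact_mod_cast this
    have h4 : (K : ℤ) ≤ |τ q| := by omega
    exact_mod_cast h4
  have hterm : ∀ q ∈ T, ((1 + |p q.1 - p q.2|) ^ 2)⁻¹ ≤ ((τ q : ℝ) ^ 2)⁻¹ := by
    intro q hq
    have h1 := abs_floor_sub_floor_lt (p q.1) (p q.2)
    have hpos : 0 < |(τ q : ℝ)| := hK0.trans_le (hτK q hq)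
    rw [← sq_abs (τ q : ℝ)]
    gcongr
    linarith
  -- fibrewise over `t`
  have hmaps : ∀ q ∈ T, τ q ∈ T.image τ := fun q hq ↦ mem_image_of_mem τ hq
  rw [← sum_fiberwise_of_maps_to hmaps]
  have hfib : ∀ t ∈ T.image τ, ∑ q ∈ T with τ q = t, ((1 + |p q.1 - p q.2|) ^ 2)⁻¹ ≤
      ((t : ℝ) ^ 2)⁻¹ * P := by
    intro t _
    calc ∑ q ∈ T with τ q = t, ((1 + |p q.1 - p q.2|) ^ 2)⁻¹
        ≤ ∑ q ∈ T with τ q = t, ((t : ℝ) ^ 2)⁻¹ := by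
          refine sum_le_sum fun q hq ↦ ?_
          rw [mem_filter] at hq
          rw [← hq.2]
          exact hterm q hq.1
      _ = ((T.filter fun q ↦ τ q = t).card : ℝ) * ((t : ℝ) ^ 2)⁻¹ := by
          rw [sum_const, nsmul_eq_mul]
      _ ≤ P * ((t : ℝ) ^ 2)⁻¹ := by
          refine mul_le_mul_of_nonneg_right ?_ (by positivity)
          refine le_trans ?_ (card_filter_floor_sub_floor_eq_le s p t)
          exact_mod_cast card_le_card fun q hq ↦ by
            simp only [hT, mem_filter] at hq ⊢
            exact ⟨hq.1.1, hq.2⟩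
      _ = ((t : ℝ) ^ 2)⁻¹ * P := mul_comm _ _
  -- `∑_{t ∈ τ(T)} t⁻² ≤ 4 / K`
  have hsumt : ∑ t ∈ T.image τ, ((t : ℝ) ^ 2)⁻¹ ≤ 4 / K := by
    set J := (T.image τ).image Int.natAbs with hJ
    have hmaps' : ∀ t ∈ T.image τ, t.natAbs ∈ J := fun t ht ↦ mem_image_of_mem _ ht
    rw [← sum_fiberwise_of_maps_to hmaps']
    have hfib' : ∀ j ∈ J, ∑ t ∈ (T.image τ) with t.natAbs = j, ((t : ℝ) ^ 2)⁻¹ ≤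
        2 * ((j : ℝ) ^ 2)⁻¹ := by
      intro j _
      have hval : ∀ t ∈ (T.image τ).filter (fun t ↦ t.natAbs = j),
          ((t : ℝ) ^ 2)⁻¹ = ((j : ℝ) ^ 2)⁻¹ := by
        intro t ht
        rw [mem_filter] at ht
        rw [← ht.2, Nat.cast_natAbs, Int.cast_abs, sq_abs]
      rw [sum_congr rfl hval, sum_const, nsmul_eq_mul]
      refine mul_le_mul_of_nonneg_right ?_ (by positivity)
      have hsub : (T.image τ).filter (fun t ↦ t.natAbs = j) ⊆ {(j : ℤ), -(j : ℤ)} := by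
        intro t ht
        rw [mem_filter] at ht
        rw [mem_insert, mem_singleton]
        omega
      calc (((T.image τ).filter fun t ↦ t.natAbs = j).card : ℝ) ≤ (({(j : ℤ), -(j : ℤ)} : Finset ℤ).card : ℝ) := by
            exact_mod_cast card_le_card hsub
        _ ≤ 2 := by exact_mod_cast card_insert_le _ _
    have hJK : ∀ j ∈ J, K ≤ j := by
      intro j hj
      rw [hJ, mem_image] at hj
      obtain ⟨t, ht, rfl⟩ := hj
      rw [mem_image] at ht
      obtain ⟨q, hq, rfl⟩ := ht
      have := hτK q hq
      rw [← Int.cast_abs, ← Nat.cast_natAbs] at this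
      exact_mod_cast this
    calc ∑ j ∈ J, ∑ t ∈ (T.image τ) with t.natAbs = j, ((t : ℝ) ^ 2)⁻¹
        ≤ ∑ j ∈ J, 2 * ((j : ℝ) ^ 2)⁻¹ := sum_le_sum hfib'
      _ = 2 * ∑ j ∈ J, ((j : ℝ) ^ 2)⁻¹ := by rw [mul_sum]
      _ ≤ 2 * ∑ j ∈ Ioo (K - 1) (J.sup id + 1), ((j : ℝ) ^ 2)⁻¹ := by
          refine mul_le_mul_of_nonneg_left ?_ (by norm_num)
          refine sum_le_sum_of_subset_of_nonneg (fun j hj ↦ ?_) fun j _ _ ↦ by positivity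
          rw [mem_Ioo]
          have h1 := hJK j hj
          have h2 : j ≤ J.sup id := le_sup (f := id) hj
          omega
      _ ≤ 2 * (2 / ((K - 1 : ℕ) + 1)) :=
          mul_le_mul_of_nonneg_left (sum_Ioo_inv_sq_le _ _) (by norm_num)
      _ = 4 / K := by
          rw [Nat.cast_sub hK, Nat.cast_one, sub_add_cancel]
          ring
  calc ∑ t ∈ T.image τ, ∑ q ∈ T with τ q = t, ((1 + |p q.1 - p q.2|) ^ 2)⁻¹
      ≤ ∑ t ∈ T.image τ, ((t : ℝ) ^ 2)⁻¹ * P := sum_le_sum hfib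
    _ = (∑ t ∈ T.image τ, ((t : ℝ) ^ 2)⁻¹) * P := by rw [sum_mul]
    _ ≤ 4 / K * P := mul_le_mul_of_nonneg_right hsumt hP0

/-! ## Smooth functions squeezing the indicator of an interval -/

/-- A smooth compactly supported `0 ≤ h ≤ 1` with `h = 1` on `[α, β]` and `h = 0` off
`(α − ε, β + ε)` (a `ContDiffBump` centred at `(α + β)/2`). [folklore] -/
theorem exists_smooth_ge_indicator_Icc {α β ε : ℝ} (hαβ : α ≤ β) (hε : 0 < ε) :
    ∃ h : ℝ → ℝ, ContDiff ℝ ∞ h ∧ HasCompactSupport h ∧ (∀ x, 0 ≤ h x) ∧ (∀ x, h x ≤ 1) ∧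
      (∀ x ∈ Set.Icc α β, h x = 1) ∧ (∀ x ∉ Set.Ioo (α - ε) (β + ε), h x = 0) := by
  let b : ContDiffBump ((α + β) / 2) :=
    ⟨(β - α) / 2 + ε / 2, (β - α) / 2 + ε, by linarith, by linarith⟩
  have hrIn : b.rIn = (β - α) / 2 + ε / 2 := rfl
  have hrOut : b.rOut = (β - α) / 2 + ε := rfl
  refine ⟨b, b.contDiff, b.hasCompactSupport, fun x ↦ b.nonneg, fun x ↦ b.le_one, ?_, ?_⟩
  · intro x hx
    apply b.one_of_mem_closedBall
    rw [Metric.mem_closedBall, Real.dist_eq, abs_le, hrIn]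
    constructor <;> linarith [hx.1, hx.2]
  · intro x hx
    apply b.zero_of_le_dist
    rw [Real.dist_eq, hrOut]
    by_contra hlt
    apply hx
    rw [not_le, abs_lt] at hlt
    constructor <;> linarith [hlt.1, hlt.2]

/-- A smooth compactly supported `0 ≤ h ≤ 1` with `h = 1` on `[α + ε, β − ε]` and `h = 0` off
`(α, β)`, for `α + ε < β − ε`. [folklore] -/
theorem exists_smooth_le_indicator_Icc {α β ε : ℝ} (hαβ : α + ε < β - ε) (hε : 0 < ε) :
    ∃ h : ℝ → ℝ, ContDiff ℝ ∞ h ∧ HasCompactSupport h ∧ (∀ x, 0 ≤ h x) ∧ (∀ x, h x ≤ 1) ∧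
      (∀ x ∈ Set.Icc (α + ε) (β - ε), h x = 1) ∧ (∀ x ∉ Set.Ioo α β, h x = 0) := by
  let b : ContDiffBump ((α + β) / 2) :=
    ⟨(β - α) / 2 - ε, (β - α) / 2, by linarith, by linarith⟩
  have hrIn : b.rIn = (β - α) / 2 - ε := rfl
  have hrOut : b.rOut = (β - α) / 2 := rfl
  refine ⟨b, b.contDiff, b.hasCompactSupport, fun x ↦ b.nonneg, fun x ↦ b.le_one, ?_, ?_⟩
  · intro x hx
    apply b.one_of_mem_closedBall
    rw [Metric.mem_closedBall, Real.dist_eq, abs_le, hrIn]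
    constructor <;> linarith [hx.1, hx.2]
  · intro x hx
    apply b.zero_of_le_dist
    rw [Real.dist_eq, hrOut]
    by_contra hlt
    apply hx
    rw [not_le, abs_lt] at hlt
    constructor <;> linarith [hlt.1, hlt.2]

/-! ## Integrals against a weight `0 ≤ w ≤ 1` -/

/-- If `0 ≤ h`, `h = 1` on `[a, b]` and `h · w` is integrable (`w ≥ 0`), then
`∫_a^b w ≤ ∫ h w`. [folklore] -/
theorem intervalIntegral_le_integral_mul {h w : ℝ → ℝ} {a b : ℝ} (hab : a ≤ b)
    (h0 : ∀ x, 0 ≤ h x) (h1 : ∀ x ∈ Set.Icc a b, h x = 1) (hw0 : ∀ x, 0 ≤ w x)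
    (hint : Integrable fun x ↦ h x * w x) :
    ∫ x in a..b, w x ≤ ∫ x, h x * w x := by
  rw [intervalIntegral.integral_of_le hab]
  have heq : ∫ x in Set.Ioc a b, w x = ∫ x in Set.Ioc a b, h x * w x := by
    refine setIntegral_congr_fun measurableSet_Ioc fun x hx ↦ ?_
    rw [h1 x (Set.Ioc_subset_Icc_self hx), one_mul]
  rw [heq]
  exact setIntegral_le_integral hint (Filter.Eventually.of_forall fun x ↦ mul_nonneg (h0 x) (hw0 x))

/-- If `h ≤ 1`, `h = 0` off `(a', b')`, `0 ≤ w` continuous, then `∫ h w ≤ ∫_{a'}^{b'} w`. [folklore] -/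
theorem integral_mul_le_intervalIntegral {h w : ℝ → ℝ} {a' b' : ℝ} (hab : a' ≤ b')
    (h1 : ∀ x, h x ≤ 1) (hz : ∀ x ∉ Set.Ioo a' b', h x = 0)
    (hw0 : ∀ x, 0 ≤ w x) (hw : Continuous w) :
    ∫ x, h x * w x ≤ ∫ x in a'..b', w x := by
  rw [intervalIntegral.integral_of_le hab]
  have heq : ∫ x, h x * w x = ∫ x in Set.Ioc a' b', h x * w x := by
    symm
    refine setIntegral_eq_integral_of_forall_compl_eq_zero fun x hx ↦ ?_
    rw [hz x fun hx' ↦ hx (Set.Ioo_subset_Ioc_self hx'), zero_mul]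
  rw [heq]
  have hwi : IntegrableOn w (Set.Ioc a' b') :=
    (hw.integrableOn_Icc (a := a') (b := b')).mono_set Set.Ioc_subset_Icc_self
  by_cases hhw : IntegrableOn (fun x ↦ h x * w x) (Set.Ioc a' b')
  · refine setIntegral_mono_on hhw hwi measurableSet_Ioc fun x _ ↦ ?_
    calc h x * w x ≤ 1 * w x := mul_le_mul_of_nonneg_right (h1 x) (hw0 x)
      _ = w x := one_mul _
  · rw [integral_undef hhw]
    exact setIntegral_nonneg measurableSet_Ioc fun x _ ↦ hw0 x

/-- For a continuous weight `w ≤ 1` and `a' ≤ a`, `b ≤ b'`: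
`∫_{a'}^{b'} w ≤ ∫_a^b w + (a − a') + (b' − b)`. [folklore] -/
theorem intervalIntegral_le_intervalIntegral_add {w : ℝ → ℝ} (hw : Continuous w)
    (hw1 : ∀ x, w x ≤ 1) {a' a b b' : ℝ} (h₁ : a' ≤ a) (h₃ : b ≤ b') :
    ∫ x in a'..b', w x ≤ (∫ x in a..b, w x) + (a - a') + (b' - b) := by
  have hi : ∀ u v : ℝ, IntervalIntegrable w volume u v := fun u v ↦ hw.intervalIntegrable u v
  have hsplit : ∫ x in a'..b', w x =
      (∫ x in a'..a, w x) + (∫ x in a..b, w x) + ∫ x in b..b', w x := by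
    rw [intervalIntegral.integral_add_adjacent_intervals (hi a' a) (hi a b),
      intervalIntegral.integral_add_adjacent_intervals (hi a' b) (hi b b')]
  have hle : ∀ u v : ℝ, u ≤ v → ∫ x in u..v, w x ≤ v - u := by
    intro u v huv
    have := intervalIntegral.integral_mono_on huv (hi u v) intervalIntegrable_const
      (fun x _ ↦ hw1 x)
    simpa using this
  have e1 := hle a' a h₁
  have e2 := hle b b' h₃
  linarith

/-- For a continuous weight `0 ≤ w` and `a ≤ a₁ ≤ b₁ ≤ b`: `∫_{a₁}^{b₁} w ≤ ∫_a^b w`. [folklore] -/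
theorem intervalIntegral_mono_interval {w : ℝ → ℝ} (hw : Continuous w) (hw0 : ∀ x, 0 ≤ w x)
    {a a₁ b₁ b : ℝ} (h₁ : a ≤ a₁) (h₂ : a₁ ≤ b₁) (h₃ : b₁ ≤ b) :
    ∫ x in a₁..b₁, w x ≤ ∫ x in a..b, w x :=
  intervalIntegral.integral_mono_interval h₁ h₂ h₃
    (Filter.Eventually.of_forall fun x ↦ hw0 x) (hw.intervalIntegrable _ _)

end PairCount

end Literature.NumberTheory.LFunctions

end
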